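import Summits.BirchSwinnertonDyer.BirchSwinnertonDyer.Theorems.GenusKolyvaginAtTwoTorsionCellD0ParitySigns
import Literature.NumberTheory.EllipticCurves.TwoDescentHilbertQuadraticForm
import Literature.NumberTheory.EllipticCurves.TwoDescentKummerBridgeRat
import HarnessLib

/-!
# D0≤2, parity of the genus twist, II: the out-place sum of the descent-form bits vanishes

Crux R″ `RankOneTwoTorsionResidualAtTwo` (stmt-27478), LINE 49 «full_vertex», stub D0≤2
`FullTorsionGenusSelmerLawUpToTwoAtTwo`, slice `#Q₀ = 2`, the `2`-PARITY HALF of `#Sel⁽²⁾(E₀^{(−p₀q₁q₂)}) = 8`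
made UNCONDITIONAL.  For `E/ℚ` with rational `2`-torsion and the Hilbert-symbol Tate form
`Q_v(a, b) = (a, b)_v (a, D₂)_v (b, D₁)_v` (`Literature/…/TwoDescentHilbertQuadraticForm.lean`: it kills the local Kummer
image at every finite place): **`sum_descentFormBits_out_eq_zero`** — if a class `c ∈ H¹(ℚ, E[2])` with components
`[a], [b]` supported on `S ∪ {p, q₁, q₂}` satisfies `E`'s local Selmer condition at every prime of `S ∋ 2` (where the
root differences are units off `S`), then the four bits `Q_∞, Q_p, Q_{q₁}, Q_{q₂}` sum to `0` — the total isotropy of the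
localisation of the RELAXED Selmer group in `⊕_{v ∈ {∞,p,q₁,q₂}} H¹(ℚ_v, E[2])` (KMR Def. 3.3 (iii) + Def. 3.8), from the
local vanishing at `S` (`localSign_descentForm_eq_one_of_mem_selmerLocalKer`), even valuations elsewhere, and Hilbert
reciprocity (`…ParitySigns.prod_localSign_descentForm_eq_one`).

Everything is proved; no LINE 49 statement is restated; BSD is not advanced by this file alone.

## References

* [KlagsbrunMazurRubin2013] Z. Klagsbrun, B. Mazur, K. Rubin, Ann. of Math. 178 (2013), Def. 3.3, Def. 3.8, Thm. 3.9.
* [Serre1973] J.-P. Serre, *A Course in Arithmetic*, Ch. III §1.2 Thm. 1, §2.1 Thm. 3.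
* [SilvermanAEC2009] J. H. Silverman, *The Arithmetic of Elliptic Curves*, 2nd ed., Prop. X.1.4, Prop. X.4.9.
-/

noncomputable section

open scoped Classical

namespace Summit.BirchSwinnertonDyer.BirchSwinnertonDyer.Theorems.GenusKolyvaginAtTwo.TorsionCellD0

open WeierstrassCurve WeierstrassCurve.Affine WeierstrassCurve.Affine.Point
open Literature.NumberTheory.GaloisRepresentations Literature.NumberTheory.EllipticCurves Field
open Literature.NumberTheory.EllipticCurves.TwoDescentLocal
open Literature.NumberTheory.EllipticCurves.KramerTwoDescent
open Literature.NumberTheory.QuadraticForms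
open IsDedekindDomain NumberField Rat.HeightOneSpectrum

/-! ## §3 The out-place sum for a class satisfying the local conditions at `S` -/

section OutSum

variable (E : WeierstrassCurve ℚ) [E.IsElliptic] {e₁ e₂ e₃ : ℚ}
variable (S : Finset ℕ) {p q₁ q₂ : ℕ} [hp : Fact p.Prime] [hq₁ : Fact q₁.Prime] [hq₂ : Fact q₂.Prime]

/-- **The form signs of a class in the local Selmer condition at `v` are trivial, in Serre's currency**: for a finite
place `v` of `ℚ` over the prime `ℓ`, integers `A, B, D₁', D₂'` representing the square classes of the components
`a, b` of `c` and of `D₁, D₂`, if `c ∈ selmerLocalKer E ℚ_v 2` then `localSign ℓ A B · localSign ℓ A D₂' · localSign ℓ B D₁' = 1`.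
[cite: SilvermanAEC2009, Prop. X.1.4, Prop. X.4.9] [cite: Serre1973, Ch. III §1.2 Thm. 1] -/
theorem localSign_descentForm_eq_one_of_mem_selmerLocalKer (h : E.toAffine.SplitTwoTorsion e₁ e₂ e₃)
    (v : HeightOneSpectrum (𝓞 ℚ)) {c : galH1Torsion E 2} (hc : c ∈ selmerLocalKer E (v.adicCompletion ℚ) 2)
    (a b : ℚˣ) (ha : kummerEquiv ℚ 2 (E.twoTorsionCharH1 h c) = Additive.ofMul (QuotientGroup.mk a))
    (hb : kummerEquiv ℚ 2 (E.twoTorsionCharH1 h.swap₁₂ c) = Additive.ofMul (QuotientGroup.mk b))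
    {A B D₁' D₂' : ℤ} {ca cb c₁ c₂ : ℚ} (hca : ca ≠ 0) (hcb : cb ≠ 0) (hc₁ : c₁ ≠ 0) (hc₂ : c₂ ≠ 0)
    (hA : (a : ℚ) * ca ^ 2 = A) (hB : (b : ℚ) * cb ^ 2 = B)
    (hD₁ : (e₁ - e₂) * (e₁ - e₃) * c₁ ^ 2 = D₁') (hD₂ : (e₂ - e₁) * (e₂ - e₃) * c₂ ^ 2 = D₂') :
    localSign (natGenerator v) A B * localSign (natGenerator v) A D₂' * localSign (natGenerator v) B D₁' = 1 := by
  haveI : (E.baseChange (v.adicCompletion ℚ)).IsElliptic := E.isElliptic_baseChange _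
  have key :=
    Literature.NumberTheory.EllipticCurves.TwoDescentHilbert.hilbertSymbol_descentForm_eq_one_of_mem_selmerLocalKer
      v E h hc a b ha hb
  have hA0 : A ≠ 0 := by
    have : (A : ℚ) ≠ 0 := by rw [← hA]; exact mul_ne_zero a.ne_zero (pow_ne_zero _ hca)
    exact_mod_cast this
  have hB0 : B ≠ 0 := by
    have : (B : ℚ) ≠ 0 := by rw [← hB]; exact mul_ne_zero b.ne_zero (pow_ne_zero _ hcb)
    exact_mod_cast this
  have hD₁0 : D₁' ≠ 0 := by
    have : (D₁' : ℚ) ≠ 0 := by rw [← hD₁]; exact mul_ne_zero h.c_ne_zero (pow_ne_zero _ hc₁)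
    exact_mod_cast this
  have hD₂0 : D₂' ≠ 0 := by
    have : (D₂' : ℚ) ≠ 0 := by rw [← hD₂]; exact mul_ne_zero h.swap₁₂.c_ne_zero (pow_ne_zero _ hc₂)
    exact_mod_cast this
  rw [hilbertSymbol_algebraMap_rat_eq hca hcb hA hB, hilbertSymbol_algebraMap_rat_eq hca hc₂ hA hD₂,
    hilbertSymbol_algebraMap_rat_eq hcb hc₁ hB hD₁, hilbertSymbol_rat_eq_localSign v hA0 hB0,
    hilbertSymbol_rat_eq_localSign v hA0 hD₂0, hilbertSymbol_rat_eq_localSign v hB0 hD₁0] at key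
  exact key

/-- **The out-place sum of the form bits vanishes** (total isotropy of the localisation of the relaxed Selmer group
at `{∞, p, q₁, q₂}`).  Setting: `E/ℚ` with rational `2`-torsion whose root differences are units off the finite set of
primes `S ∋ 2`; primes `p, q₁, q₂ ∉ S`, each `≡ 3 (mod 4)`.  Let `c ∈ H¹(ℚ, E[2])` have components `[a], [b]` with EVEN
valuation at every prime outside `S ∪ {p, q₁, q₂}`, and satisfy `E`'s local Selmer condition at every prime of `S`.
Then the bits `Q_∞ + Q_p + Q_{q₁} + Q_{q₂}` of the form `Q_v(a,b) = (a,b)_v (a,D₂)_v (b,D₁)_v` sum to `0` in `ℤ/2`,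
where at `v ∈ {p,q₁,q₂}`: `Q_v = αβ + βρ + ασ + α·qr_v(D₂) + β·qr_v(D₁)` (`α, β` the parities, `ρ, σ` the residue bits
of `a, b` at `v`) and `Q_∞ = s_a s_b + s_a·s(D₂) + s_b·s(D₁)` (sign bits).  Proof: the form signs are `1` at the primes of
`S` (the local condition, `localSign_descentForm_eq_one_of_mem_selmerLocalKer`), `1` at the primes outside
`S ∪ {p,q₁,q₂}` (even valuations), and multiply to `1` over all places (Hilbert reciprocity,
`prod_localSign_descentForm_eq_one`). [cite: KlagsbrunMazurRubin2013, Def. 3.3, Thm. 3.9] [cite: Serre1973, Ch. III §2.1 Thm. 3] -/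
theorem sum_descentFormBits_out_eq_zero (h : E.toAffine.SplitTwoTorsion e₁ e₂ e₃) (h2S : 2 ∈ S)
    (hgood : ∀ ℓ : ℕ, (hℓ : ℓ.Prime) → ℓ ∉ S → haveI : Fact ℓ.Prime := ⟨hℓ⟩;
      padicValRat ℓ (e₁ - e₂) = 0 ∧ padicValRat ℓ (e₁ - e₃) = 0 ∧ padicValRat ℓ (e₂ - e₃) = 0)
    (hpS : p ∉ S) (hq₁S : q₁ ∉ S) (hq₂S : q₂ ∉ S) (hpq₁ : p ≠ q₁) (hpq₂ : p ≠ q₂) (hne : q₁ ≠ q₂)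
    (hp4 : p % 4 = 3) (hq₁4 : q₁ % 4 = 3) (hq₂4 : q₂ % 4 = 3)
    {c : galH1Torsion E 2} (a b : ℚˣ)
    (ha : kummerEquiv ℚ 2 (E.twoTorsionCharH1 h c) = Additive.ofMul (QuotientGroup.mk a))
    (hb : kummerEquiv ℚ 2 (E.twoTorsionCharH1 h.swap₁₂ c) = Additive.ofMul (QuotientGroup.mk b))
    (hsupp : ∀ ℓ : ℕ, (hℓ : ℓ.Prime) → ℓ ∉ S → ℓ ≠ p → ℓ ≠ q₁ → ℓ ≠ q₂ → haveI : Fact ℓ.Prime := ⟨hℓ⟩;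
      parityBit ℓ (a : ℚ) = 0 ∧ parityBit ℓ (b : ℚ) = 0)
    (hloc : ∀ v : HeightOneSpectrum (𝓞 ℚ), natGenerator v ∈ S → c ∈ selmerLocalKer E (v.adicCompletion ℚ) 2) :
    (signBit (a : ℚ) * signBit (b : ℚ) + signBit (a : ℚ) * signBit ((e₂ - e₁) * (e₂ - e₃)) +
        signBit (b : ℚ) * signBit ((e₁ - e₂) * (e₁ - e₃))) +
      (parityBit p (a : ℚ) * parityBit p (b : ℚ) + parityBit p (b : ℚ) * qrBit p (a : ℚ) + parityBit p (a : ℚ) * qrBit p (b : ℚ) +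
        parityBit p (a : ℚ) * qrBit p ((e₂ - e₁) * (e₂ - e₃)) + parityBit p (b : ℚ) * qrBit p ((e₁ - e₂) * (e₁ - e₃))) +
      (parityBit q₁ (a : ℚ) * parityBit q₁ (b : ℚ) + parityBit q₁ (b : ℚ) * qrBit q₁ (a : ℚ) + parityBit q₁ (a : ℚ) * qrBit q₁ (b : ℚ) +
        parityBit q₁ (a : ℚ) * qrBit q₁ ((e₂ - e₁) * (e₂ - e₃)) + parityBit q₁ (b : ℚ) * qrBit q₁ ((e₁ - e₂) * (e₁ - e₃))) +
      (parityBit q₂ (a : ℚ) * parityBit q₂ (b : ℚ) + parityBit q₂ (b : ℚ) * qrBit q₂ (a : ℚ) + parityBit q₂ (a : ℚ) * qrBit q₂ (b : ℚ) +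
        parityBit q₂ (a : ℚ) * qrBit q₂ ((e₂ - e₁) * (e₂ - e₃)) + parityBit q₂ (b : ℚ) * qrBit q₂ ((e₁ - e₂) * (e₁ - e₃))) = 0 := by
  -- integral representatives of the four square classes
  obtain ⟨A, ca, hA0, hca, hA⟩ := Rat.exists_mul_sq_eq_intCast a.ne_zero
  obtain ⟨B, cb, hB0, hcb, hB⟩ := Rat.exists_mul_sq_eq_intCast b.ne_zero
  obtain ⟨D₁', c₁, hD₁0, hc₁, hD₁⟩ := Rat.exists_mul_sq_eq_intCast h.c_ne_zero
  obtain ⟨D₂', c₂, hD₂0, hc₂, hD₂⟩ := Rat.exists_mul_sq_eq_intCast h.swap₁₂.c_ne_zero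
  have hN : 2 * A * B * D₁' * D₂' ≠ 0 :=
    mul_ne_zero (mul_ne_zero (mul_ne_zero (mul_ne_zero two_ne_zero hA0) hB0) hD₁0) hD₂0
  -- the form sign as a function of the prime
  set f : ℕ → ℤ := fun ℓ => localSign ℓ A B * localSign ℓ A D₂' * localSign ℓ B D₁' with hf
  -- (1) `f ℓ = 1` for every prime `ℓ ∉ {p, q₁, q₂}`
  have hf1 : ∀ ℓ : ℕ, ℓ.Prime → ℓ ≠ p → ℓ ≠ q₁ → ℓ ≠ q₂ → f ℓ = 1 := by
    intro ℓ hℓ hℓp hℓ₁ hℓ₂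
    haveI : Fact ℓ.Prime := ⟨hℓ⟩
    by_cases hℓS : ℓ ∈ S
    · -- local condition at `ℓ ∈ S`
      set v : HeightOneSpectrum (𝓞 ℚ) := (primesEquiv (R := 𝓞 ℚ)).symm ⟨ℓ, hℓ⟩ with hv
      have hgen : natGenerator v = ℓ :=
        congrArg Subtype.val ((primesEquiv (R := 𝓞 ℚ)).apply_symm_apply ⟨ℓ, hℓ⟩)
      have := localSign_descentForm_eq_one_of_mem_selmerLocalKer E h v (hloc v (hgen ▸ hℓS)) a b ha hb hca hcb hc₁ hc₂
        hA hB hD₁ hD₂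
      rwa [hgen] at this
    · -- even valuations off `S ∪ {p, q₁, q₂}`
      have hℓ2 : ℓ ≠ 2 := fun h2 => hℓS (h2 ▸ h2S)
      obtain ⟨hpa, hpb⟩ := hsupp ℓ hℓ hℓS hℓp hℓ₁ hℓ₂
      obtain ⟨g12, g13, g23⟩ := hgood ℓ hℓ hℓS
      have heA := even_padicValInt_of_parityBit_eq_zero (ℓ := ℓ) ((bits_eq_of_mul_sq_eq (ℓ := ℓ) a.ne_zero hca hA).1 ▸ hpa)
      have heB := even_padicValInt_of_parityBit_eq_zero (ℓ := ℓ) ((bits_eq_of_mul_sq_eq (ℓ := ℓ) b.ne_zero hcb hB).1 ▸ hpb)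
      have hpD₁ : parityBit ℓ ((e₁ - e₂) * (e₁ - e₃)) = 0 := by
        rw [parityBit, padicValRat.mul (sub_ne_zero.mpr h.ne₁₂) (sub_ne_zero.mpr h.ne₁₃), g12, g13, add_zero, Int.cast_zero]
      have hpD₂ : parityBit ℓ ((e₂ - e₁) * (e₂ - e₃)) = 0 := by
        rw [parityBit, padicValRat.mul (sub_ne_zero.mpr h.ne₁₂.symm) (sub_ne_zero.mpr h.ne₂₃),
          show e₂ - e₁ = -(e₁ - e₂) by ring, padicValRat.neg, g12, g23, add_zero, Int.cast_zero]
      have heD₁ := even_padicValInt_of_parityBit_eq_zero (ℓ := ℓ) ((bits_eq_of_mul_sq_eq (ℓ := ℓ) h.c_ne_zero hc₁ hD₁).1 ▸ hpD₁)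
      have heD₂ := even_padicValInt_of_parityBit_eq_zero (ℓ := ℓ)
        ((bits_eq_of_mul_sq_eq (ℓ := ℓ) h.swap₁₂.c_ne_zero hc₂ hD₂).1 ▸ hpD₂)
      show localSign ℓ A B * localSign ℓ A D₂' * localSign ℓ B D₁' = 1
      rw [localSign_eq_one_of_even hℓ2 hA0 hB0 heA heB, localSign_eq_one_of_even hℓ2 hA0 hD₂0 heA heD₂,
        localSign_eq_one_of_even hℓ2 hB0 hD₁0 heB heD₁]
      norm_num
  -- (2) reciprocity: `sign_∞ · ∏_{ℓ ∈ P} f ℓ = 1`, and the product collapses to `f p · f q₁ · f q₂`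
  have hrec := prod_localSign_descentForm_eq_one hA0 hB0 hD₁0 hD₂0
  set P := (2 * A * B * D₁' * D₂').natAbs.primeFactors with hP
  have hPprime : ∀ ℓ ∈ P, ℓ.Prime := fun ℓ hℓ => Nat.prime_of_mem_primeFactors hℓ
  have hprod : ∏ ℓ ∈ P, f ℓ = f p * f q₁ * f q₂ := by
    have hsub : ({p, q₁, q₂} : Finset ℕ) ⊆ P ∪ {p, q₁, q₂} := Finset.subset_union_right
    have e1 : ∏ ℓ ∈ P, f ℓ = ∏ ℓ ∈ P ∪ {p, q₁, q₂}, f ℓ := by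
      refine Finset.prod_subset Finset.subset_union_left fun ℓ hℓU hℓP => ?_
      · have hℓprime : ℓ.Prime := by
          rcases Finset.mem_union.mp hℓU with h' | h'
          · exact hPprime ℓ h'
          · simp only [Finset.mem_insert, Finset.mem_singleton] at h'
            rcases h' with rfl | rfl | rfl
            exacts [hp.out, hq₁.out, hq₂.out]
        exact localSign_descentForm_eq_one_of_not_mem hℓprime hℓP hN
    have e2 : ∏ ℓ ∈ P ∪ {p, q₁, q₂}, f ℓ = ∏ ℓ ∈ ({p, q₁, q₂} : Finset ℕ), f ℓ := by
      refine (Finset.prod_subset hsub fun ℓ hℓU hℓ3 => ?_).symm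
      have hℓprime : ℓ.Prime := by
        rcases Finset.mem_union.mp hℓU with h' | h'
        · exact hPprime ℓ h'
        · exact absurd h' hℓ3
      simp only [Finset.mem_insert, Finset.mem_singleton, not_or] at hℓ3
      exact hf1 ℓ hℓprime hℓ3.1 hℓ3.2.1 hℓ3.2.2
    rw [e1, e2, Finset.prod_insert (by simp [hpq₁, hpq₂]), Finset.prod_insert (by simp [hne]), Finset.prod_singleton]
    ring
  rw [hprod] at hrec
  -- (3) everything in bits
  obtain ⟨hpa, hra, hsa⟩ := bits_eq_of_mul_sq_eq (ℓ := p) a.ne_zero hca hA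
  obtain ⟨hpb, hrb, hsb⟩ := bits_eq_of_mul_sq_eq (ℓ := p) b.ne_zero hcb hB
  obtain ⟨hp1, hr1, hs1⟩ := bits_eq_of_mul_sq_eq (ℓ := p) h.c_ne_zero hc₁ hD₁
  obtain ⟨hp2, hr2, hs2⟩ := bits_eq_of_mul_sq_eq (ℓ := p) h.swap₁₂.c_ne_zero hc₂ hD₂
  obtain ⟨hpa₁, hra₁, -⟩ := bits_eq_of_mul_sq_eq (ℓ := q₁) a.ne_zero hca hA
  obtain ⟨hpb₁, hrb₁, -⟩ := bits_eq_of_mul_sq_eq (ℓ := q₁) b.ne_zero hcb hB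
  obtain ⟨hp1₁, hr1₁, -⟩ := bits_eq_of_mul_sq_eq (ℓ := q₁) h.c_ne_zero hc₁ hD₁
  obtain ⟨hp2₁, hr2₁, -⟩ := bits_eq_of_mul_sq_eq (ℓ := q₁) h.swap₁₂.c_ne_zero hc₂ hD₂
  obtain ⟨hpa₂, hra₂, -⟩ := bits_eq_of_mul_sq_eq (ℓ := q₂) a.ne_zero hca hA
  obtain ⟨hpb₂, hrb₂, -⟩ := bits_eq_of_mul_sq_eq (ℓ := q₂) b.ne_zero hcb hB
  obtain ⟨hp1₂, hr1₂, -⟩ := bits_eq_of_mul_sq_eq (ℓ := q₂) h.c_ne_zero hc₁ hD₁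
  obtain ⟨hp2₂, hr2₂, -⟩ := bits_eq_of_mul_sq_eq (ℓ := q₂) h.swap₁₂.c_ne_zero hc₂ hD₂
  -- the `D`'s are units at `p, q₁, q₂`
  have hparD : ∀ {ℓ : ℕ} [Fact ℓ.Prime], ℓ ∉ S →
      parityBit ℓ ((e₁ - e₂) * (e₁ - e₃)) = 0 ∧ parityBit ℓ ((e₂ - e₁) * (e₂ - e₃)) = 0 := by
    intro ℓ _ hℓS
    obtain ⟨g12, g13, g23⟩ := hgood ℓ Fact.out hℓS
    refine ⟨?_, ?_⟩
    · rw [parityBit, padicValRat.mul (sub_ne_zero.mpr h.ne₁₂) (sub_ne_zero.mpr h.ne₁₃), g12, g13, add_zero, Int.cast_zero]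
    · rw [parityBit, padicValRat.mul (sub_ne_zero.mpr h.ne₁₂.symm) (sub_ne_zero.mpr h.ne₂₃),
        show e₂ - e₁ = -(e₁ - e₂) by ring, padicValRat.neg, g12, g23, add_zero, Int.cast_zero]
  obtain ⟨hD₁p, hD₂p⟩ := hparD (ℓ := p) hpS
  obtain ⟨hD₁q₁, hD₂q₁⟩ := hparD (ℓ := q₁) hq₁S
  obtain ⟨hD₁q₂, hD₂q₂⟩ := hparD (ℓ := q₂) hq₂S
  have hpn2 : p ≠ 2 := fun h2 => hpS (h2 ▸ h2S)
  have hq₁n2 : q₁ ≠ 2 := fun h2 => hq₁S (h2 ▸ h2S)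
  have hq₂n2 : q₂ ≠ 2 := fun h2 => hq₂S (h2 ▸ h2S)
  have fval : ∀ {ℓ : ℕ} [Fact ℓ.Prime], ℓ ≠ 2 → ℓ % 4 = 3 →
      f ℓ = (-1) ^ (parityBit ℓ (A : ℚ) * parityBit ℓ (B : ℚ) + parityBit ℓ (B : ℚ) * qrBit ℓ (A : ℚ) +
        parityBit ℓ (A : ℚ) * qrBit ℓ (B : ℚ) +
        (parityBit ℓ (A : ℚ) * parityBit ℓ (D₂' : ℚ) + parityBit ℓ (D₂' : ℚ) * qrBit ℓ (A : ℚ) + parityBit ℓ (A : ℚ) * qrBit ℓ (D₂' : ℚ)) +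
        (parityBit ℓ (B : ℚ) * parityBit ℓ (D₁' : ℚ) + parityBit ℓ (D₁' : ℚ) * qrBit ℓ (B : ℚ) + parityBit ℓ (B : ℚ) * qrBit ℓ (D₁' : ℚ))).val := by
    intro ℓ _ hℓ2 hℓ4
    simp only [hf, localSign, if_neg hℓ2]
    rw [localSignOdd_eq_neg_one_pow_bits hℓ4 hA0 hB0, localSignOdd_eq_neg_one_pow_bits hℓ4 hA0 hD₂0,
      localSignOdd_eq_neg_one_pow_bits hℓ4 hB0 hD₁0, ← neg_one_pow_val_add, ← neg_one_pow_val_add]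
  rw [fval hpn2 hp4, fval hq₁n2 hq₁4, fval hq₂n2 hq₂4, localSignInfty_eq_neg_one_pow_signBit,
    localSignInfty_eq_neg_one_pow_signBit, localSignInfty_eq_neg_one_pow_signBit, ← neg_one_pow_val_add,
    ← neg_one_pow_val_add, ← neg_one_pow_val_add, ← neg_one_pow_val_add, ← neg_one_pow_val_add,
    neg_one_pow_val_eq_one_iff] at hrec
  rw [hsa, hsb, hs1, hs2, hpa, hpb, hra, hrb, hr1, hr2, hpa₁, hpb₁, hra₁, hrb₁, hr1₁, hr2₁, hpa₂, hpb₂, hra₂, hrb₂, hr1₂, hr2₂]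
  rw [← hp1, ← hp2, ← hp1₁, ← hp2₁, ← hp1₂, ← hp2₂, hD₁p, hD₂p, hD₁q₁, hD₂q₁, hD₁q₂, hD₂q₂] at hrec
  simp only [mul_zero, zero_mul, add_zero, zero_add] at hrec
  linear_combination hrec

end OutSum

end Summit.BirchSwinnertonDyer.BirchSwinnertonDyer.Theorems.GenusKolyvaginAtTwo.TorsionCellD0

end
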